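import Literature.AnabelianGeometry.EtaleTheta.KummerClass
import Mathlib.RepresentationTheory.Homological.GroupCohomology.Functoriality

/-!
# Functoriality of Kummer classes under (covariant) equivariant morphisms of pairs

Source: LANA Project interim report [LANA2026Report], §6.1, pp. 31–32 ("Such Kummer maps are
functorial in the following sense. First, a morphism (or, say, an *equivariant co-morphism*) …"),
and S. Mochizuki, *Topics in absolute anabelian geometry III* [MochizukiAbsTopIII2015], Definition
3.1 (ii) p. 67 (a morphism of MLF-Galois `T`-pairs `φ : (Π₁ ↷ M₁) → (Π₂ ↷ M₂)` is "a morphism of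
objects `φ_M : M₁ → M₂` of `T`, together with a compatible continuous homomorphism `φ_Π : Π₁ → Π₂`")
and Proposition 3.2 (ii) p. 71 / Proposition 3.3 (i) p. 73 (the Kummer maps
`M^H_T → H¹(H, μ_Ẑ(M_T))` are obtained "functorially").

The companion file `KummerFunctoriality.lean` treats the CO-morphism shape of loc. cit.
(`φ_* : G_Y → G_X` contravariant, `φ^* : A_X → A_Y` covariant), where the two data assemble to ONE
map `H¹(H, Λ(A_X)) → H¹(H', Λ(A_Y))`.  A morphism of pairs in the sense of [AbsTopIII] Def. 3.1 (ii)
is COVARIANT in both slots — `φ : G₁ → G₂` AND `ψ : A₁ → A₂` with `ψ(g • a) = φ(g) • ψ(a)` — and is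
therefore not a co-morphism: for subgroups `H₁ ≤ G₁`, `H₂ ≤ G₂` with `φ(H₁) ≤ H₂` the induced maps on
`H¹` form a COSPAN into the cohomology of `H₁` with coefficients `Λ(A₂)` restricted along `φ`:

  `H¹(H₁, Λ(A₁)) —push(ψ)→ H¹(H₁, res_φ Λ(A₂)) ←pull(φ)— H¹(H₂, Λ(A₂))`.

## What is here (proved)

* `EquivariantMorphism` : the data `(φ, ψ)` with the equivariance identity (discrete version);
* `EquivariantMorphism.pullH1` / `.pushH1` : the two legs of the cospan, both instances of
  Mathlib's `groupCohomology.map` (along `φ| : H₁ → H₂` with the identity on coefficients, resp.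
  along `id_{H₁}` with `Λ(ψ)` on coefficients);
* `EquivariantMorphism.pullH1_kummerClassOfRootSystem` / **`pullH1_kummerClass`** : NATURALITY of the
  Kummer classes — for `a ∈ A₁^{H₁}`, `b ∈ A₂^{H₂}` with `ψ(a) = b`,
  `pull(φ) (κ_{H₂}(b)) = push(ψ) (κ_{H₁}(a))` (cochain level: both sides are
  `γ ↦ (ψ((γ • x_n) / x_n))_n` for a compatible root system `x` of `a`).

Consumers (by name): the MODEL Kummer theories of [AbsTopIII] Prop. 3.2 (ii) (`TM`,
`AbsoluteAnabelian/MonoidKummerModel.lean`) and Prop. 3.3 (i) (`TLG`/`TCG`,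
`AbsoluteAnabelian/UnitKummerModel.lean`), whose `H¹` is exactly the `groupCohomology.H1 (cyclotomeRep …)`
used here.  Conventions as in `KummerClass.lean`: groups and modules in `Type` (Mathlib's
`groupCohomology.map` is single-universe), everything discrete.  Nothing here bears on [IUTchIII]
Cor. 3.12; this is classical Kummer theory.
-/

namespace Literature.AnabelianGeometry.EtaleTheta

open groupCohomology CategoryTheory

/-- A (covariant) **equivariant morphism of pairs** `(φ, ψ) : (G₁ ↷ A₁) → (G₂ ↷ A₂)`: a group
homomorphism `φ : G₁ → G₂` and a homomorphism `ψ : A₁ → A₂` IN THE SAME DIRECTION with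
`ψ(g • a) = φ(g) • ψ(a)` — the shape of a morphism of `T`-pairs of [AbsTopIII] Def. 3.1 (ii)
("a morphism of objects `φ_M : M₁ → M₂` … together with a compatible continuous homomorphism
`φ_Π : Π₁ → Π₂`"; topology and the conditions on arithmetic quotients are not needed for the
cohomological functoriality and are omitted here).
[cite: MochizukiAbsTopIII2015, Definition 3.1 (ii) p.67] -/
structure EquivariantMorphism (G₁ A₁ G₂ A₂ : Type*) [Group G₁] [CommGroup A₁]
    [MulDistribMulAction G₁ A₁] [Group G₂] [CommGroup A₂] [MulDistribMulAction G₂ A₂] where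
  /-- `φ : G₁ → G₂` -/
  groupHom : G₁ →* G₂
  /-- `ψ : A₁ → A₂` -/
  map : A₁ →* A₂
  /-- the equivariance `ψ(g • a) = φ(g) • ψ(a)` -/
  map_smul : ∀ (g : G₁) (a : A₁), map (g • a) = groupHom g • map a

namespace EquivariantMorphism

section General

variable {G₁ A₁ G₂ A₂ : Type*} [Group G₁] [CommGroup A₁] [MulDistribMulAction G₁ A₁]
  [Group G₂] [CommGroup A₂] [MulDistribMulAction G₂ A₂] (c : EquivariantMorphism G₁ A₁ G₂ A₂)

/-- `ψ` carries `H₁`-invariants to `φ(H₁)`-invariants. [cite: MochizukiAbsTopIII2015, Definition 3.1 (ii) p.67] -/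
theorem map_mem_fixedPoints_map {H₁ : Subgroup G₁} {a : A₁} (ha : a ∈ MulAction.fixedPoints H₁ A₁) :
    c.map a ∈ MulAction.fixedPoints (H₁.map c.groupHom) A₂ := by
  rintro ⟨_, g, hg, rfl⟩
  change c.groupHom g • c.map a = c.map a
  rw [← c.map_smul]
  exact congrArg c.map (ha ⟨g, hg⟩)

/-- The restriction `φ| : H₁ → H₂` of `φ` to subgroups with `φ(H₁) ≤ H₂`.
[cite: MochizukiAbsTopIII2015, Definition 3.1 (ii) p.67] -/
def groupHomRestrict {H₁ : Subgroup G₁} {H₂ : Subgroup G₂} (hH : H₁.map c.groupHom ≤ H₂) :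
    H₁ →* H₂ :=
  (c.groupHom.restrict H₁).codRestrict H₂ fun γ => hH ⟨γ, γ.2, rfl⟩

/-- Values of the restricted homomorphism. [cite: MochizukiAbsTopIII2015, Definition 3.1 (ii) p.67] -/
@[simp] theorem coe_groupHomRestrict_apply {H₁ : Subgroup G₁} {H₂ : Subgroup G₂}
    (hH : H₁.map c.groupHom ≤ H₂) (γ : H₁) :
    ((c.groupHomRestrict hH γ : H₂) : G₂) = c.groupHom γ := rfl

/-- `Λ(ψ) : Λ(A₁) → Λ(A₂)` is `H₁`-equivariant when `H₁` acts on `Λ(A₂)` through `φ`.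
[cite: LANA2026Report, §6.1 p.32] -/
theorem cyclotome_map_smul (g : G₁) (ζ : cyclotome A₁) :
    cyclotome.map c.map (g • ζ) = c.groupHom g • cyclotome.map c.map ζ :=
  Subtype.ext (funext fun _ => c.map_smul g _)

/-- Cochain-level naturality: for a root system `x` of `a ∈ A₁^{H₁}`, the Kummer cocycle of the image
root system `ψ ∘ x` (a root system of `ψ(a)`, invariant under `H₂ ⊇ φ(H₁)`) evaluated at `φ(γ)` is
`Λ(ψ)` of the Kummer cocycle of `x` at `γ`. [cite: LANA2026Report, §6.1 p.32] -/
theorem kummerCocycle_map {H₁ : Subgroup G₁} {H₂ : Subgroup G₂} (hH : H₁.map c.groupHom ≤ H₂)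
    {a : A₁} (x : RootSystem a) (ha : a ∈ MulAction.fixedPoints H₁ A₁)
    (hb : c.map a ∈ MulAction.fixedPoints H₂ A₂) (γ : H₁) :
    (x.map c.map).kummerCocycle hb (c.groupHomRestrict hH γ) =
      cyclotome.map c.map (x.kummerCocycle ha γ) := by
  refine Subtype.ext (funext fun n => ?_)
  change (c.groupHom γ • c.map (x.root n)) / c.map (x.root n) =
    c.map (((γ : G₁) • x.root n) / x.root n)
  rw [map_div, c.map_smul]

end General

section Cohomology

variable {G₁ A₁ G₂ A₂ : Type} [Group G₁] [CommGroup A₁] [MulDistribMulAction G₁ A₁]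
  [Group G₂] [CommGroup A₂] [MulDistribMulAction G₂ A₂] (c : EquivariantMorphism G₁ A₁ G₂ A₂)
  {H₁ : Subgroup G₁} {H₂ : Subgroup G₂} (hH : H₁.map c.groupHom ≤ H₂)

/-- The coefficient module of the comparison: `Λ(A₂)` with `H₁` acting through `φ| : H₁ → H₂`
(Mathlib `Rep.res`). [cite: LANA2026Report, §6.1 p.32] -/
noncomputable abbrev resRep : Rep ℤ H₁ := Rep.res (c.groupHomRestrict hH) (cyclotomeRep (A := A₂) H₂)

/-- **Pull-back** `φ^* : H¹(H₂, Λ(A₂)) → H¹(H₁, res_φ Λ(A₂))` along `φ| : H₁ → H₂` (Mathlib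
`groupCohomology.map` with the identity on coefficients). [cite: LANA2026Report, §6.1 p.32] -/
noncomputable abbrev pullH1 : H1 (cyclotomeRep (A := A₂) H₂) ⟶ H1 (c.resRep hH) :=
  groupCohomology.map (c.groupHomRestrict hH) (𝟙 (c.resRep hH)) 1

/-- `Λ(ψ) : Λ(A₁) → res_φ Λ(A₂)` as a morphism of `ℤ`-linear `H₁`-representations.
[cite: LANA2026Report, §6.1 p.32] -/
noncomputable def cyclotomeHom : cyclotomeRep (A := A₁) H₁ ⟶ c.resRep hH :=
  Rep.ofHom
    { toLinearMap := (MonoidHom.toAdditive (cyclotome.map c.map)).toIntLinearMap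
      isIntertwining' := fun γ =>
        LinearMap.ext fun v => c.cyclotome_map_smul γ (Additive.toMul (α := cyclotome A₁) v) }

/-- `cyclotomeHom` on elements. [cite: LANA2026Report, §6.1 p.32] -/
@[simp] theorem cyclotomeHom_hom_apply (v : Additive (cyclotome A₁)) :
    (c.cyclotomeHom hH).hom v = Additive.ofMul (cyclotome.map c.map v.toMul) := rfl

/-- **Push-forward** `ψ_* : H¹(H₁, Λ(A₁)) → H¹(H₁, res_φ Λ(A₂))` (change of coefficients along `Λ(ψ)`;
Mathlib `groupCohomology.map` along `id_{H₁}`). [cite: LANA2026Report, §6.1 p.32] -/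
noncomputable abbrev pushH1 : H1 (cyclotomeRep (A := A₁) H₁) ⟶ H1 (c.resRep hH) :=
  groupCohomology.map (MonoidHom.id H₁) (c.cyclotomeHom hH) 1

/-- **Naturality of Kummer classes, root-system form**: for a root system `x` of `a ∈ A₁^{H₁}` with
`ψ(a)` invariant under `H₂`, the pull-back of the Kummer class of `ψ(a)` (computed with `ψ ∘ x`)
equals the push-forward of the Kummer class of `a` (computed with `x`).
[cite: LANA2026Report, §6.1 p.32] -/
theorem pullH1_kummerClassOfRootSystem {a : A₁} (x : RootSystem a)
    (ha : a ∈ MulAction.fixedPoints H₁ A₁) (hb : c.map a ∈ MulAction.fixedPoints H₂ A₂) :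
    c.pullH1 hH (kummerClassOfRootSystem H₂ (x.map c.map) hb) =
      c.pushH1 hH (kummerClassOfRootSystem H₁ x ha) := by
  rw [kummerClassOfRootSystem, kummerClassOfRootSystem, pullH1, pushH1, H1π_comp_map_apply,
    H1π_comp_map_apply]
  congr 1
  refine cocycles₁_ext fun γ => ?_
  rw [coe_mapCocycles₁, coe_mapCocycles₁]
  change Additive.ofMul ((x.map c.map).kummerCocycle hb (c.groupHomRestrict hH γ)) =
    (c.cyclotomeHom hH).hom (kummerCocycles₁ H₁ x ha γ)
  rw [c.kummerCocycle_map hH x ha hb γ]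
  rfl

variable [RootableBy A₁ ℕ] [RootableBy A₂ ℕ]

/-- **Naturality of the Kummer classes under an equivariant morphism of pairs** — the functoriality
of the Kummer maps `A^H → H¹(H, Λ(A))` "in the following sense" of [LANA2026Report, §6.1 p.32], in the
covariant shape of [AbsTopIII] Def. 3.1 (ii) / Prop. 3.2 (ii): for `a ∈ A₁^{H₁}` and `b ∈ A₂^{H₂}` with
`ψ(a) = b` and `φ(H₁) ≤ H₂`,
`φ^* (κ_{H₂}(b)) = ψ_* (κ_{H₁}(a))` in `H¹(H₁, res_φ Λ(A₂))`.
[cite: LANA2026Report, §6.1 p.32] -/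
theorem pullH1_kummerClass (a : invariants (A := A₁) H₁) (b : invariants (A := A₂) H₂)
    (hab : c.map a = b) :
    c.pullH1 hH (kummerClass H₂ b) = c.pushH1 hH (kummerClass H₁ a) := by
  have hb : c.map (a : A₁) ∈ MulAction.fixedPoints H₂ A₂ := by rw [hab]; exact b.2
  have e : kummerClass H₂ b =
      kummerClassOfRootSystem H₂ ((RootSystem.ofRootableBy (a : A₁)).map c.map) hb := by
    obtain ⟨b, hb'⟩ := b
    cases hab
    exact kummerClass_eq_of_rootSystem H₂ _ _
  rw [e, kummerClass]
  exact c.pullH1_kummerClassOfRootSystem hH _ a.2 hb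

/-- The same naturality for the bundled Kummer maps `kummerMapFixed`, as an identity of
homomorphisms out of the subgroup of those `H₁`-invariants whose image is `H₂`-invariant — stated on
elements: for every `a ∈ A₁^{H₁}` with `ψ(a) ∈ A₂^{H₂}`,
`φ^* (kummerMapFixed H₂ (ψ a)) = ψ_* (kummerMapFixed H₁ a)`. [cite: LANA2026Report, §6.1 p.32] -/
theorem pullH1_kummerMapFixed (a : invariants (A := A₁) H₁)
    (hb : c.map (a : A₁) ∈ MulAction.fixedPoints H₂ A₂) :
    c.pullH1 hH (kummerMapFixed H₂ (Additive.ofMul ⟨c.map a, hb⟩)) =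
      c.pushH1 hH (kummerMapFixed H₁ (Additive.ofMul a)) := by
  rw [kummerMapFixed_apply, kummerMapFixed_apply]
  exact c.pullH1_kummerClass hH a ⟨c.map a, hb⟩ rfl

end Cohomology

end EquivariantMorphism

end Literature.AnabelianGeometry.EtaleTheta
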